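import Summits.Langlands.Langlands.Theses.DisagreementBeurling

open scoped BigOperators Topology Manifold Classical MeasureTheory ProbabilityTheory Matrix InnerProductSpace ComplexConjugate ContinuousMap
open Filter Set Function TopologicalSpace MeasureTheory

set_option linter.dupNamespace false

/-!
# Birth skeleton of the piece X₂ `MonomialStrongArtin3` (split child of `CanonicalDescent36`)

Two stubs: (C) `stub_automorphicInductionMonomial` — EXISTENCE of the automorphic induction: an
irreducible monomial `ρ : Γ_M → GL₃(ℂ)` is `Ind_{Γ_L}^{Γ_M} χ` for a cubic `L/M`, and `AI(χ)` is an
automorphic representation of `GL₃(𝔸_M)` (an `AutomorphicRepData`, not yet known cuspidal) of Artin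
infinity type matching `ρ` a.e. (JPSS 1981 for non-normal `L/M`, Arthur–Clozel III.6.2 for cyclic
`L/M`); (D) `stub_cuspidalOfIrreduciblePartner` — CUSPIDALITY: an automorphic representation of
`GL₃(𝔸_M)` matching an IRREDUCIBLE Galois representation a.e. is nearly equivalent to a cuspidal one
(Langlands' classification + Jacquet–Shalika: `L^S(s, Π × Π̃)` vs the simple pole of
`L^S(s, ρ ⊗ ρ̄)` at `s = 1`). `MonomialStrongArtin3_of` composes them (sorry-free).
-/

namespace Summit.Langlands.Langlands.Cruxes.CanonicalDescent36.Birth.MonomialStrongArtin3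

/-- The piece X₂ (verbatim the split child `MonomialStrongArtin3`). -/
def Piece : Prop :=
  ∀ (M : Type) [Field M] [NumberField M] (ρ : Literature.NumberTheory.GaloisRepresentations.FramedGaloisRep M ℂ 3), ρ.toGaloisRep.IsIrreducible → (∃ g : GL (Fin 3) ℂ, ∀ (σ : Field.absoluteGaloisGroup M) (i : Fin 3), ∃! j : Fin 3, ((Literature.NumberTheory.GaloisRepresentations.FramedRep.conj g ρ σ : GL (Fin 3) ℂ) : Matrix (Fin 3) (Fin 3) ℂ) i j ≠ 0) → ∃ (hcpt : Literature.NumberTheory.Automorphic.isCompact_glFiniteIntegralLevel 3 M) (P : Literature.NumberTheory.Automorphic.CuspidalAutomorphicRepData 3 M hcpt), P.1.HasInfinityType (fun _ => Multiset.replicate 3 ({ a := 0, b := 0, exists_int_sub := ⟨0, (sub_zero (0 : ℂ)).trans Int.cast_zero.symm⟩ } : Literature.NumberTheory.Automorphic.ArchWeight)) ∧ ∀ᶠ w : IsDedekindDomain.HeightOneSpectrum (NumberField.RingOfIntegers M) in Filter.cofinite, ∃ γ : Multiset ℂ, P.1.HasSatakeParamAt w γ ∧ ρ.IsUnramifiedAt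 w ∧ ρ.HasFrobCharpolyAt w (Literature.NumberTheory.Automorphic.satakePolynomial γ)

/-- STUB C — automorphic induction of a monomial rank-3 Artin representation exists as an
automorphic representation matching it a.e. (JPSS81 / AC III.6; size XL). -/
theorem stub_automorphicInductionMonomial :
    ∀ (M : Type) [Field M] [NumberField M] (ρ : Literature.NumberTheory.GaloisRepresentations.FramedGaloisRep M ℂ 3), ρ.toGaloisRep.IsIrreducible → (∃ g : GL (Fin 3) ℂ, ∀ (σ : Field.absoluteGaloisGroup M) (i : Fin 3), ∃! j : Fin 3, ((Literature.NumberTheory.GaloisRepresentations.FramedRep.conj g ρ σ : GL (Fin 3) ℂ) : Matrix (Fin 3) (Fin 3) ℂ) i j ≠ 0) → ∃ (hcpt : Literature.NumberTheory.Automorphic.isCompact_glFiniteIntegralLevel 3 M) (A₀ : Literature.NumberTheory.Automorphic.AutomorphicRepData (Literature.NumberTheory.Automorphic.AutomorphyDatum.gl 3 M hcpt)), A₀.HasInfinityType (fun _ => Multiset.replicate 3 ({ a := 0, b := 0, exists_int_sub := ⟨0, (sub_zero (0 : ℂ)).trans Int.cast_zero.symm⟩ } : Literature.NumberTheory.Automorphic.ArchWeight))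 ∧ (∀ᶠ w : IsDedekindDomain.HeightOneSpectrum (NumberField.RingOfIntegers M) in Filter.cofinite, ∃ γ : Multiset ℂ, A₀.HasSatakeParamAt w γ ∧ ρ.IsUnramifiedAt w ∧ ρ.HasFrobCharpolyAt w (Literature.NumberTheory.Automorphic.satakePolynomial γ)) := by
  sorry

/-- STUB D — an automorphic partner of an irreducible rank-3 Artin representation is (nearly
equivalent to) a cuspidal one (Langlands classification + JS81 poles; size L). -/
theorem stub_cuspidalOfIrreduciblePartner :
    ∀ (M : Type) [Field M] [NumberField M] (ρ : Literature.NumberTheory.GaloisRepresentations.FramedGaloisRep M ℂ 3), ρ.toGaloisRep.IsIrreducible → ∀ (hcpt : Literature.NumberTheory.Automorphic.isCompact_glFiniteIntegralLevel 3 M) (A₀ : Literature.NumberTheory.Automorphic.AutomorphicRepData (Literature.NumberTheory.Automorphic.AutomorphyDatum.gl 3 M hcpt)), A₀.HasInfinityType (fun _ => Multiset.replicate 3 ({ a := 0, b := 0, exists_int_sub := ⟨0, (sub_zero (0 : ℂ)).trans Int.cast_zero.symm⟩ } : Literature.NumberTheory.Automorphic.ArchWeight)) → (∀ᶠ w : IsDedekindDomain.HeightOneSpectrum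 (NumberField.RingOfIntegers M) in Filter.cofinite, ∃ γ : Multiset ℂ, A₀.HasSatakeParamAt w γ ∧ ρ.IsUnramifiedAt w ∧ ρ.HasFrobCharpolyAt w (Literature.NumberTheory.Automorphic.satakePolynomial γ)) → ∃ (P : Literature.NumberTheory.Automorphic.CuspidalAutomorphicRepData 3 M hcpt), P.1.HasInfinityType (fun _ => Multiset.replicate 3 ({ a := 0, b := 0, exists_int_sub := ⟨0, (sub_zero (0 : ℂ)).trans Int.cast_zero.symm⟩ } : Literature.NumberTheory.Automorphic.ArchWeight)) ∧ (∀ᶠ w : IsDedekindDomain.HeightOneSpectrum (NumberField.RingOfIntegers M) in Filter.cofinite, ∃ γ : Multiset ℂ, P.1.HasSatakeParamAt w γ ∧ ρ.IsUnramifiedAt w ∧ ρ.HasFrobCharpolyAt w (Literature.NumberTheory.Automorphic.satakePolynomial γ)) := by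
  sorry

/-- X₂ from the two stubs (statement level, sorry-free). -/
theorem piece_of_statements :
    (∀ (M : Type) [Field M] [NumberField M] (ρ : Literature.NumberTheory.GaloisRepresentations.FramedGaloisRep M ℂ 3), ρ.toGaloisRep.IsIrreducible → (∃ g : GL (Fin 3) ℂ, ∀ (σ : Field.absoluteGaloisGroup M) (i : Fin 3), ∃! j : Fin 3, ((Literature.NumberTheory.GaloisRepresentations.FramedRep.conj g ρ σ : GL (Fin 3) ℂ) : Matrix (Fin 3) (Fin 3) ℂ) i j ≠ 0) → ∃ (hcpt : Literature.NumberTheory.Automorphic.isCompact_glFiniteIntegralLevel 3 M) (A₀ : Literature.NumberTheory.Automorphic.AutomorphicRepData (Literature.NumberTheory.Automorphic.AutomorphyDatum.gl 3 M hcpt)), A₀.HasInfinityType (fun _ => Multiset.replicate 3 ({ a := 0, b := 0, exists_int_sub := ⟨0, (sub_zero (0 : ℂ)).trans Int.cast_zero.symm⟩ } : Literature.NumberTheory.Automorphic.ArchWeight)) ∧ (∀ᶠ w : IsDedekindDomain.HeightOneSpectrum (NumberField.RingOfIntegers M) in Filter.cofinite, ∃ γ : Multiset ℂ, A₀.HasSatakeParamAt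 w γ ∧ ρ.IsUnramifiedAt w ∧ ρ.HasFrobCharpolyAt w (Literature.NumberTheory.Automorphic.satakePolynomial γ))) → (∀ (M : Type) [Field M] [NumberField M] (ρ : Literature.NumberTheory.GaloisRepresentations.FramedGaloisRep M ℂ 3), ρ.toGaloisRep.IsIrreducible → ∀ (hcpt : Literature.NumberTheory.Automorphic.isCompact_glFiniteIntegralLevel 3 M) (A₀ : Literature.NumberTheory.Automorphic.AutomorphicRepData (Literature.NumberTheory.Automorphic.AutomorphyDatum.gl 3 M hcpt)), A₀.HasInfinityType (fun _ => Multiset.replicate 3 ({ a := 0, b := 0, exists_int_sub := ⟨0, (sub_zero (0 : ℂ)).trans Int.cast_zero.symm⟩ } : Literature.NumberTheory.Automorphic.ArchWeight)) → (∀ᶠ w : IsDedekindDomain.HeightOneSpectrum (NumberField.RingOfIntegers M) in Filter.cofinite, ∃ γ : Multiset ℂ, A₀.HasSatakeParamAt w γ ∧ ρ.IsUnramifiedAt w ∧ ρ.HasFrobCharpolyAt w (Literature.NumberTheory.Automorphic.satakePolynomial γ)) → ∃ (P : Literature.NumberTheory.Automorphic.CuspidalAutomorphicRepData 3 M hcpt),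 P.1.HasInfinityType (fun _ => Multiset.replicate 3 ({ a := 0, b := 0, exists_int_sub := ⟨0, (sub_zero (0 : ℂ)).trans Int.cast_zero.symm⟩ } : Literature.NumberTheory.Automorphic.ArchWeight)) ∧ (∀ᶠ w : IsDedekindDomain.HeightOneSpectrum (NumberField.RingOfIntegers M) in Filter.cofinite, ∃ γ : Multiset ℂ, P.1.HasSatakeParamAt w γ ∧ ρ.IsUnramifiedAt w ∧ ρ.HasFrobCharpolyAt w (Literature.NumberTheory.Automorphic.satakePolynomial γ))) → Piece := by
  intro hC hD M _ _ ρ hirr hmono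
  obtain ⟨hcpt, A₀, hinf, hmatch⟩ := hC M ρ hirr hmono
  obtain ⟨P, hP, hPmatch⟩ := hD M ρ hirr hcpt A₀ hinf hmatch
  exact ⟨hcpt, P, hP, hPmatch⟩

/-- X₂ `MonomialStrongArtin3` from the registered stubs. -/
theorem MonomialStrongArtin3_of : Piece :=
  piece_of_statements stub_automorphicInductionMonomial stub_cuspidalOfIrreduciblePartner

end Summit.Langlands.Langlands.Cruxes.CanonicalDescent36.Birth.MonomialStrongArtin3
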